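import Literature.Geometry.Riemannian.CurvatureFamilyBounds
import Literature.Geometry.Lorentzian.CurvatureSymmetries
import Literature.Geometry.Lorentzian.LeviCivitaProofs
import HarnessLib

/-!
# The sectional curvature of a compact Riemannian manifold is bounded above

Topic `Geometry/Riemannian`; a small support file of the programme towards the named fact
`Weinstein1968_exists_metric_two_le_multiplicity_of_mem_cutLocus` (`WeinsteinCutLocus.lean`): in
Weinstein's proof the curvature bound `Λ₀` of the background metric `g₀` OUTSIDE the modified
disk is fixed once and for all by compactness, before the disk is made thin (hypothesis (curv) of
`WeinsteinCriterion.lean`). Here: for a `C^∞` Riemannian metric `g` on a compact Hausdorff manifold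
there is `Λ ≥ 0` with

  `Rm(X, Y, Y, X) ≤ Λ · (g(X,X) g(Y,Y) - g(X,Y)²)`   for all `x` and `X, Y ∈ T_xM`

(`exists_curvatureForm_le_of_compactSpace`), i.e. sectional curvature `≤ Λ` in the Gram-determinant
form used by the comparison estimates of `ConjugateRadiusBound.lean` / `JacobiEnergyEstimates.lean`.
Proof: the frame bound `|Rm(X,Y,Z,W)| ≤ K` on `g`-unit-bounded vectors
(`IsContMDiffFamilyOn.exists_curvatureBoundedBy_of_isCompact` applied to the constant family,
Topping 2006, §5.3) gives `Rm(X',Y,Y,X') ≤ K |X'|² |Y|²` by multilinearity; with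
`X' = X - (g(X,Y)/g(Y,Y)) Y` one has `Rm(X,Y,Y,X) = Rm(X',Y,Y,X')` (`R(Y,Y) = 0` and
`g(R(X,Y)Y, Y) = 0`, O'Neill 1983, Prop. 3.36 (1)–(2)) and `|X'|²|Y|² = g(X,X)g(Y,Y) - g(X,Y)²`.
No definitions, no named facts.

## References

* P. Topping, *Lectures on the Ricci flow* (2006), §5.3 (curvature bounded on compact sets).
  [Topping2006]
* B. O'Neill, *Semi-Riemannian Geometry* (1983), Ch. 3, Prop. 3.36 (1)–(2), Def. 3.39.
  [ONeill1983]
-/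

noncomputable section

open Bundle Set Function
open scoped Manifold ContDiff Topology

namespace Literature.Geometry.Riemannian

open Literature.Geometry.Lorentzian
open Literature.Geometry.Lorentzian.PseudoRiemannianMetric

variable {E : Type*} [NormedAddCommGroup E] [NormedSpace ℝ E] {H : Type*} [TopologicalSpace H]
  {I : ModelWithCorners ℝ E H} {M : Type*} [TopologicalSpace M] [ChartedSpace H M]
  [IsManifold I ∞ M] [FiniteDimensional ℝ E] [CompleteSpace E] [T2Space M] [CompactSpace M]
  (g : PseudoRiemannianMetric I ∞ E (TangentSpace I : M → Type _)) [g.HasLeviCivita]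

/-- **Sectional curvature is bounded above on a compact manifold** (Gram form): for a `C^∞`
Riemannian metric `g` on a compact Hausdorff manifold there is `Λ ≥ 0` with
`Rm(X, Y, Y, X) ≤ Λ (g(X,X) g(Y,Y) - g(X,Y)²)` for all tangent vectors `X, Y` at all points
(`Rm = g.curvatureForm g.leviCivita`, Lee's sign). [cite: Topping2006, §5.3 (proof of Thm. 5.3.1, p. 46)]
[cite: ONeill1983, Ch. 3, Prop. 3.36 (1)–(2)] -/
theorem exists_curvatureForm_le_of_compactSpace (hg : g.IsRiemannian) :
    ∃ Λ : ℝ, 0 ≤ Λ ∧ ∀ (x : M) (X Y : TangentSpace I x),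
      g.curvatureForm g.leviCivita x X Y Y X ≤
        Λ * (g.val x X X * g.val x Y Y - g.val x X Y ^ 2) := by
  have hLC : g.IsLeviCivita g.leviCivita := isLeviCivita_leviCivita_holds (g := g)
  have hcompat : g.IsCompatible g.leviCivita := hLC.2
  have hreg : g.leviCivita.IsLocallyContMDiff 1 :=
    g.isLocallyContMDiff_leviCivita_holds 1 (by exact_mod_cast le_top)
  have h2 : (2 : ℕ∞ω) ≤ ((⊤ : ℕ∞) : ℕ∞ω) := by
    rw [show (2 : ℕ∞ω) = ((2 : ℕ∞) : ℕ∞ω) from rfl]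
    exact WithTop.coe_le_coe.2 le_top
  -- the frame bound from compactness
  obtain ⟨K, hK⟩ := (isContMDiffFamilyOn_const g {0}).exists_curvatureBoundedBy_of_isCompact
    (cov := fun _ : ℝ ↦ g.leviCivita) (fun _ _ ↦ hLC) isCompact_singleton (subset_refl _)
    (fun _ _ ↦ hg)
  have hK0 : CurvatureBoundedBy g g.leviCivita K := hK 0 (mem_singleton 0)
  refine ⟨max K 0, le_max_right _ _, fun x X Y ↦ ?_⟩
  set Λ : ℝ := max K 0 with hΛ
  have hΛ0 : 0 ≤ Λ := le_max_right _ _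
  have hKΛ : K ≤ Λ := le_max_left _ _
  -- positive semidefiniteness
  have hnn : ∀ u : TangentSpace I x, 0 ≤ g.val x u u := fun u ↦ by
    by_cases hu : u = 0
    · subst hu
      simp
    · exact (hg x u hu).le
  -- curvature vanishes when a slot is `0` (explicit `map_zero`, avoiding class search)
  have hR0 : ∀ V Z W : TangentSpace I x, g.curvatureForm g.leviCivita x 0 V Z W = 0 :=
      fun V Z W ↦ by
    simp only [curvatureForm]
    rw [ContinuousLinearMap.map_zero (g.leviCivita.curvature x)]
    rw [zero_apply, zero_apply,
      ContinuousLinearMap.map_zero (g.val x), zero_apply]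
  -- the case `Y = 0`
  by_cases hY0 : Y = 0
  · subst hY0
    have h0 : g.curvatureForm g.leviCivita x X 0 0 X = 0 := by
      rw [curvatureForm_antisymm, hR0, neg_zero]
    rw [h0]
    simp
  have hYY : 0 < g.val x Y Y := hg x Y hY0
  -- `X' = X - c Y` with `c = g(X,Y)/g(Y,Y)`
  set c : ℝ := g.val x X Y / g.val x Y Y with hc
  set X' : TangentSpace I x := X - c • Y with hX'
  have hsymXY : g.val x Y X = g.val x X Y := g.symm x Y X
  -- `Rm(X, Y, Y, X) = Rm(X', Y, Y, X')`
  have h3 : g.leviCivita.curvature x Y Y Y = 0 :=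
    CovariantDerivative.curvature_self (cov := g.leviCivita) (x := x) Y Y
  have s1 : ∀ W : TangentSpace I x,
      g.curvatureForm g.leviCivita x X' Y Y W = g.curvatureForm g.leviCivita x X Y Y W := by
    intro W
    simp only [curvatureForm]
    rw [hX', ContinuousLinearMap.map_sub (g.leviCivita.curvature x),
      ContinuousLinearMap.map_smul (g.leviCivita.curvature x)]
    rw [sub_apply, sub_apply,
      smul_apply, smul_apply, h3, smul_zero, sub_zero]
  have s2 : g.curvatureForm g.leviCivita x X Y Y X' = g.curvatureForm g.leviCivita x X Y Y X := by
    have h1 : g.val x (g.leviCivita.curvature x X Y Y) Y = 0 :=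
      val_curvature_self_eq_zero hcompat hreg h2 x X Y Y
    simp only [curvatureForm]
    rw [hX', ContinuousLinearMap.map_sub, ContinuousLinearMap.map_smul, h1, smul_zero, sub_zero]
  have hRm : g.curvatureForm g.leviCivita x X Y Y X = g.curvatureForm g.leviCivita x X' Y Y X' := by
    rw [s1 X', s2]
  -- `|X'|² |Y|² = g(X,X) g(Y,Y) - g(X,Y)²`
  have hgram : g.val x X' X' * g.val x Y Y = g.val x X X * g.val x Y Y - g.val x X Y ^ 2 := by
    have h1 : g.val x X' X' = g.val x X X - 2 * c * g.val x X Y + c ^ 2 * g.val x Y Y := by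
      simp only [hX', map_sub, map_smul, sub_apply, FunLike.coe_smul,
        Pi.smul_apply, smul_eq_mul, hsymXY]
      ring
    rw [h1, hc]
    field_simp
    ring
  -- the frame bound on the normalised vectors gives `Rm(X', Y, Y, X') ≤ K |X'|² |Y|²`
  have hbound : g.curvatureForm g.leviCivita x X' Y Y X' ≤ Λ * (g.val x X' X' * g.val x Y Y) := by
    by_cases hX0 : X' = 0
    · rw [hX0, hR0]
      simp
    have hXX : 0 < g.val x X' X' := hg x X' hX0
    set a : ℝ := Real.sqrt (g.val x X' X') with ha
    set b : ℝ := Real.sqrt (g.val x Y Y) with hb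
    have ha0 : 0 < a := Real.sqrt_pos.2 hXX
    have hb0 : 0 < b := Real.sqrt_pos.2 hYY
    have ha2 : a ^ 2 = g.val x X' X' := Real.sq_sqrt hXX.le
    have hb2 : b ^ 2 = g.val x Y Y := Real.sq_sqrt hYY.le
    -- unit vectors
    have ha' : a ≠ 0 := ha0.ne'
    have hb' : b ≠ 0 := hb0.ne'
    have hua : g.val x (a⁻¹ • X') (a⁻¹ • X') ≤ 1 := by
      have h6 : g.val x (a⁻¹ • X') (a⁻¹ • X') = a⁻¹ * a⁻¹ * a ^ 2 := by
        rw [ha2]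
        simp only [map_smul, FunLike.coe_smul, Pi.smul_apply, smul_eq_mul]
        ring
      have h7 : a⁻¹ * a⁻¹ * a ^ 2 = 1 := by field_simp
      rw [h6, h7]
    have hub : g.val x (b⁻¹ • Y) (b⁻¹ • Y) ≤ 1 := by
      have h6 : g.val x (b⁻¹ • Y) (b⁻¹ • Y) = b⁻¹ * b⁻¹ * b ^ 2 := by
        rw [hb2]
        simp only [map_smul, FunLike.coe_smul, Pi.smul_apply, smul_eq_mul]
        ring
      have h7 : b⁻¹ * b⁻¹ * b ^ 2 = 1 := by field_simp
      rw [h6, h7]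
    have hK1 := (abs_le.1 (hK0 x (a⁻¹ • X') (b⁻¹ • Y) (b⁻¹ • Y) (a⁻¹ • X') hua hub hub hua)).2
    have hscale : g.curvatureForm g.leviCivita x (a⁻¹ • X') (b⁻¹ • Y) (b⁻¹ • Y) (a⁻¹ • X') =
        (a⁻¹ * b⁻¹ * b⁻¹ * a⁻¹) * g.curvatureForm g.leviCivita x X' Y Y X' := by
      simp only [curvatureForm, map_smul, FunLike.coe_smul, Pi.smul_apply, smul_eq_mul]
      ring
    rw [hscale] at hK1
    have hpos : 0 < a ^ 2 * b ^ 2 := by positivity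
    have h4 : g.curvatureForm g.leviCivita x X' Y Y X' ≤ K * (a ^ 2 * b ^ 2) := by
      have h5 : a⁻¹ * b⁻¹ * b⁻¹ * a⁻¹ = (a ^ 2 * b ^ 2)⁻¹ := by
        rw [← mul_inv, ← mul_inv, ← mul_inv]
        congr 1
        ring
      rw [h5, inv_mul_le_iff₀ hpos] at hK1
      linarith
    calc g.curvatureForm g.leviCivita x X' Y Y X' ≤ K * (a ^ 2 * b ^ 2) := h4
      _ ≤ Λ * (a ^ 2 * b ^ 2) := mul_le_mul_of_nonneg_right hKΛ hpos.le
      _ = Λ * (g.val x X' X' * g.val x Y Y) := by rw [ha2, hb2]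
  rw [hRm, ← hgram]
  exact hbound

end Literature.Geometry.Riemannian

end
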